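import Summits.Langlands.Langlands.Theorems.IrreducibilityBySelfDualityPairLBoundaryJSUnitBoxTranslateProductForm
import Summits.Langlands.Langlands.Theorems.IrreducibilityBySelfDualityPairLBoundaryJSCornerPairTranslate
import Literature.NumberTheory.Automorphic.TorusIntegrandThinSupport
import Literature.NumberTheory.Automorphic.CornerTorusIwasawaData

/-!
# Crux `PairLBoundaryJS` (stmt-Langlands-13622), line `Sketch` — stub `stub_corner_unitBox_productForm` (W-CPF),
# part 1: the corner local value theorem at a bad place

Summit `Langlands`, sub-problem `Langlands`, helper file under `Theorems/` supporting the crux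
`PairLBoundaryJS` (Arthur–Clozel (1989), Ch. 3, (2.2)), line `Sketch`, registered stub
`stub_corner_unitBox_productForm` (proved in `…PairLBoundaryJSCornerUnitBoxProductForm`; part 2 is
`…CornerUnitBoxPeel`); this file proves the registered sub-goal `stub_corner_unitBox_localValue`.

The finite-place content of the bad-place step of the Rankin–Selberg method for the CORNER pair
`GL_{m+1} × GL_m` (Jacquet–Piatetski-Shapiro–Shalika (1983), §2, (2.7)): the first function `W` lives on
`GL_{m+1}(𝔸_K)` and is evaluated along the corner `ι = glCorner : g ↦ diag(g, 1)`, whose last row is EXACTLY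
`e_{m+1}`, so the thin hypothesis of the support theorems of `…UnitBoxTranslateLocalValue` holds at every depth.

* `glCorner_mem_valuedCongruenceSubgroup_iff`, `colUnipotent_mem_valuedCongruenceSubgroup`, `level_colUnipotent` —
  `diag(·, 1)` and the column unipotents `u(b) = 1 + Σ_{i<m} b_i E_{i,m}` against the congruence subgroups and the
  spread level set;
* `corner_descent` — **descent of `diag(x, 1) = u k` (`u ∈ N_{m+1}(K_v)`) to `GL_m`**: `k` lies in the mirabolic, so
  `k = u(b) diag(k₁, 1)` (`exists_colUnipotent_mul_glCorner_eq_of_mem_mirabolic`) with `b` the last column of `k`,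
  and `x k₁⁻¹ ∈ N_m(K_v)`; `sharp_descent` — if moreover `k ∈ K♯_v = {k ∈ K_v(𝔭^M) : W(g ι_v(k)) = W(g) ∀ g}` for
  a spread `W`, then `diag(k₁, 1) = u(-b) k ∈ K♯_v` (`|b_i| ≤ exp(-M)`; `u(∓b)` lies in the spread level set);
* `corner_pair_apply_mul_ofLocal_eq` (= `stub_corner_unitBox_localValue`) — **the corner local value theorem**: for
  `W` left `ψ`-equivariant on `GL_{m+1}(𝔸_K)` and spread at `v`, `W'` left `ψ`-equivariant on `GL_m(𝔸_K)` and right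
  `K_v(𝔭^M)`-invariant, base points `G'`, `g'` with trivial `v`-components and ANY `x ∈ GL_m(K_v)`:
  `W(G' ι_v(diag(x, 1))) W̄'(g' ι_v(x)) = 𝟙[diag(x, 1) ∈ N_v K♯_v] · W(G') W̄'(g')` (`exists_sharp_of_ne_zero` of
  `…UnitBoxTranslateLocalValue` on `GL_{m+1}`, `sharp_descent`, and `ψ_v(diag(u₁, 1)) = ψ_v(u₁)`).

All proofs complete; tree theorems only.

## References

* H. Jacquet, I. I. Piatetski-Shapiro, J. A. Shalika, *Rankin–Selberg convolutions*, Amer. J. Math.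
  105 (1983), §2, (2.7) [JacquetPiatetskiShapiroShalika1983].
* J. W. Cogdell, *Analytic theory of L-functions for GL_n*, in *An Introduction to the Langlands
  Program* (2004), §2.3, §4.1 [CogdellAnalyticTheory2004].
-/

noncomputable section

-- `Summit.Langlands.Langlands.…` (summit = sub-problem name, D-0017 layout) trips `dupNamespace`
set_option linter.dupNamespace false

open scoped MatrixGroups Topology Pointwise ENNReal NNReal ComplexConjugate InnerProductSpace ContDiff
-- the place subtypes indexing `mixedSpace K` are `Fintype` classically (`NormedCommRing (mixedSpace K)`)
open scoped Classical Matrix.Norms.Operator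
open NumberField IsDedekindDomain MeasureTheory Measure Matrix Set Filter WithZero
open NumberField.mixedEmbedding
open Literature.NumberTheory.Automorphic AdelicGroupData
open Literature.NumberTheory.GaloisRepresentations (ideleGroup HeckeCharacter)
open ValuativeRel

-- no local instances needed in this file (algebra and pointwise statements only)

namespace Summit.Langlands.Langlands.Theorems.CornerUnitBoxProductForm

/-! ### The corner `diag(·, 1)` and the column unipotents against the congruence subgroups -/

section Algebra

variable {m : ℕ} {K : Type} [Field K] [NumberField K] {v : HeightOneSpectrum (𝓞 K)}

/-- The last row of `diag(x, 1)` is `e_{m+1}`. [folklore] -/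
theorem glCorner_last_apply (x : GL (Fin m) (v.adicCompletion K)) (j : Fin (m + 1)) :
    ((glCorner (v.adicCompletion K) (Nat.le_succ m) x : GL (Fin (m + 1)) (v.adicCompletion K)) :
        Matrix (Fin (m + 1)) (Fin (m + 1)) (v.adicCompletion K)) (Fin.last m) j =
      if j = Fin.last m then 1 else 0 :=
  (Literature.LinearAlgebra.Matrix.mem_mirabolic_iff_row.1 (glCorner_mem_mirabolic x)) j

/-- The last column of `diag(x, 1)` above the corner vanishes. [folklore] -/
theorem glCorner_castSucc_last (x : GL (Fin m) (v.adicCompletion K)) (i : Fin m) :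
    ((glCorner (v.adicCompletion K) (Nat.le_succ m) x : GL (Fin (m + 1)) (v.adicCompletion K)) :
        Matrix (Fin (m + 1)) (Fin (m + 1)) (v.adicCompletion K)) (Fin.castSucc i) (Fin.last m) = 0 := by
  rw [glCorner_apply_val, dif_pos (by rw [Fin.val_castSucc]; exact i.2), dif_neg (by rw [Fin.val_last]; exact lt_irrefl m)]

/-- The entries of `diag(g, 1)` are integral when those of `g` are. [folklore] -/
theorem valued_glCorner_apply_le_one {g : GL (Fin m) (v.adicCompletion K)}
    (hg : ∀ i j, Valued.v ((g : Matrix (Fin m) (Fin m) (v.adicCompletion K)) i j) ≤ 1) (i j : Fin (m + 1)) :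
    Valued.v (((glCorner (v.adicCompletion K) (Nat.le_succ m) g : GL (Fin (m + 1)) (v.adicCompletion K)) :
      Matrix (Fin (m + 1)) (Fin (m + 1)) (v.adicCompletion K)) i j) ≤ 1 := by
  rw [glCorner_apply_val]
  by_cases hi : (i : ℕ) < m <;> by_cases hj : (j : ℕ) < m
  · rw [dif_pos hi, dif_pos hj]; exact hg _ _
  · rw [dif_pos hi, dif_neg hj, Valuation.map_zero]; exact zero_le
  · rw [dif_neg hi, if_pos hj, Valuation.map_zero]; exact zero_le
  · rw [dif_neg hi, if_neg hj]
    split_ifs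
    · rw [Valuation.map_one]
    · rw [Valuation.map_zero]; exact zero_le

/-- The congruence `diag(g, 1) ≡ 1` is that of `g`. [folklore] -/
theorem valued_glCorner_sub_one_apply_le {g : GL (Fin m) (v.adicCompletion K)} {c : ℤᵐ⁰}
    (hg : ∀ i j, Valued.v (((g : Matrix (Fin m) (Fin m) (v.adicCompletion K)) - 1) i j) ≤ c) (i j : Fin (m + 1)) :
    Valued.v ((((glCorner (v.adicCompletion K) (Nat.le_succ m) g : GL (Fin (m + 1)) (v.adicCompletion K)) :
      Matrix (Fin (m + 1)) (Fin (m + 1)) (v.adicCompletion K)) - 1) i j) ≤ c := by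
  rw [Matrix.sub_apply, glCorner_apply_val, Matrix.one_apply]
  by_cases hi : (i : ℕ) < m <;> by_cases hj : (j : ℕ) < m
  · rw [dif_pos hi, dif_pos hj]
    have h := hg ⟨i, hi⟩ ⟨j, hj⟩
    rw [Matrix.sub_apply, Matrix.one_apply] at h
    have hij : ((⟨i, hi⟩ : Fin m) = ⟨j, hj⟩) ↔ i = j := by simp only [Fin.ext_iff]
    simp only [hij] at h
    exact h
  · have hij : i ≠ j := fun h => hj (h ▸ hi)
    rw [dif_pos hi, dif_neg hj, if_neg hij, sub_zero, Valuation.map_zero]; exact zero_le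
  · have hij : i ≠ j := fun h => hi (h ▸ hj)
    rw [dif_neg hi, if_pos hj, if_neg hij, sub_zero, Valuation.map_zero]; exact zero_le
  · rw [dif_neg hi, if_neg hj, sub_self, Valuation.map_zero]; exact zero_le

/-- **`diag(g, 1) ∈ K_{m+1,v}(c) ↔ g ∈ K_{m,v}(c)`** for the valued congruence subgroups of any radius `c`.
[folklore] -/
theorem glCorner_mem_valuedCongruenceSubgroup_iff {c : ℤᵐ⁰} (g : GL (Fin m) (v.adicCompletion K)) :
    glCorner (v.adicCompletion K) (Nat.le_succ m) g ∈ valuedCongruenceSubgroup (Fin (m + 1)) c ↔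
      g ∈ valuedCongruenceSubgroup (Fin m) c := by
  constructor
  · intro h
    obtain ⟨h1, h2, h3⟩ := mem_valuedCongruenceSubgroup_iff.1 h
    rw [← map_inv] at h2
    refine mem_valuedCongruenceSubgroup_iff.2 ⟨fun i j => ?_, fun i j => ?_, fun i j => ?_⟩
    · rw [← glCorner_apply_castSucc]; exact h1 _ _
    · rw [← glCorner_apply_castSucc]; exact h2 _ _
    · have h := h3 (Fin.castSucc i) (Fin.castSucc j)
      rw [Matrix.sub_apply, glCorner_apply_castSucc, Matrix.one_apply] at h
      simp only [Fin.castSucc_inj] at h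
      rw [Matrix.sub_apply, Matrix.one_apply]
      exact h
  · intro h
    obtain ⟨h1, h2, h3⟩ := mem_valuedCongruenceSubgroup_iff.1 h
    refine mem_valuedCongruenceSubgroup_iff.2 ⟨valued_glCorner_apply_le_one h1, fun i j => ?_,
      valued_glCorner_sub_one_apply_le h3⟩
    rw [← map_inv]
    exact valued_glCorner_apply_le_one h2 i j

/-- The entries of `u(b) - 1`: `b_i` at `(i, m)` for `i < m`, `0` elsewhere. [folklore] -/
theorem colUnipotent_sub_one_apply (b : Fin m → v.adicCompletion K) (i j : Fin (m + 1)) :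
    (((colUnipotent (m + 1) (Nat.le_succ m) (Multiplicative.ofAdd b) : GL (Fin (m + 1)) (v.adicCompletion K)) :
        Matrix (Fin (m + 1)) (Fin (m + 1)) (v.adicCompletion K)) - 1) i j =
      if hi : (i : ℕ) < m then (if (j : ℕ) = m then b ⟨i, hi⟩ else 0) else 0 := by
  rw [Matrix.sub_apply, colUnipotent_apply_val, Matrix.one_apply]
  ring

/-- `|(u(b) - 1)_{ij}| ≤ c` when `|b_i| ≤ c`. [folklore] -/
theorem valued_colUnipotent_sub_one_apply_le {b : Fin m → v.adicCompletion K} {c : ℤᵐ⁰}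
    (hb : ∀ i, Valued.v (b i) ≤ c) (i j : Fin (m + 1)) :
    Valued.v ((((colUnipotent (m + 1) (Nat.le_succ m) (Multiplicative.ofAdd b) : GL (Fin (m + 1)) (v.adicCompletion K)) :
        Matrix (Fin (m + 1)) (Fin (m + 1)) (v.adicCompletion K)) - 1) i j) ≤ c := by
  rw [colUnipotent_sub_one_apply]
  split_ifs
  · exact hb _
  · rw [Valuation.map_zero]; exact zero_le
  · rw [Valuation.map_zero]; exact zero_le

/-- The entries of `u(b)` are integral when `|b_i| ≤ 1`. [folklore] -/
theorem valued_colUnipotent_apply_le_one {b : Fin m → v.adicCompletion K} (hb : ∀ i, Valued.v (b i) ≤ 1)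
    (i j : Fin (m + 1)) :
    Valued.v (((colUnipotent (m + 1) (Nat.le_succ m) (Multiplicative.ofAdd b) : GL (Fin (m + 1)) (v.adicCompletion K)) :
        Matrix (Fin (m + 1)) (Fin (m + 1)) (v.adicCompletion K)) i j) ≤ 1 := by
  rw [← sub_add_cancel (((colUnipotent (m + 1) (Nat.le_succ m) (Multiplicative.ofAdd b) : GL (Fin (m + 1))
    (v.adicCompletion K)) : Matrix (Fin (m + 1)) (Fin (m + 1)) (v.adicCompletion K)) i j)
    ((1 : Matrix (Fin (m + 1)) (Fin (m + 1)) (v.adicCompletion K)) i j), ← Matrix.sub_apply]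
  refine (Valuation.map_add _ _ _).trans (max_le (valued_colUnipotent_sub_one_apply_le hb i j) ?_)
  rw [Matrix.one_apply]
  split_ifs
  · rw [Valuation.map_one]
  · rw [Valuation.map_zero]; exact zero_le

/-- **`u(b) ∈ K_v(c)` when `|b_i| ≤ c ≤ 1`** (`u(b)⁻¹ = u(-b)`). [folklore] -/
theorem colUnipotent_mem_valuedCongruenceSubgroup {b : Fin m → v.adicCompletion K} {c : ℤᵐ⁰} (hc : c ≤ 1)
    (hb : ∀ i, Valued.v (b i) ≤ c) :
    colUnipotent (m + 1) (Nat.le_succ m) (Multiplicative.ofAdd b) ∈ valuedCongruenceSubgroup (Fin (m + 1)) c := by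
  have hb1 : ∀ i, Valued.v (b i) ≤ 1 := fun i => (hb i).trans hc
  have hnb1 : ∀ i, Valued.v ((-b) i) ≤ 1 := fun i => by rw [Pi.neg_apply, Valuation.map_neg]; exact hb1 i
  refine mem_valuedCongruenceSubgroup_iff.2
    ⟨valued_colUnipotent_apply_le_one hb1, fun i j => ?_, valued_colUnipotent_sub_one_apply_le hb⟩
  rw [← map_inv, ← ofAdd_neg]
  exact valued_colUnipotent_apply_le_one hnb1 i j

/-- **`u(b)` lies in the spread level set of `(t, M)` when `|b_i| ≤ exp(-M)`**:
`|(u(b) - 1)_{ij} t_j| ≤ exp(-M) |t_i|` (only `(i, m)`, `i < m`, contributes, and `|t_m| ≤ |t_i|`). [folklore] -/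
theorem level_colUnipotent {b : Fin m → v.adicCompletion K} {t : Fin (m + 1) → (v.adicCompletion K)ˣ} {M : ℤ}
    (hmono : ∀ i j : Fin (m + 1), i ≤ j → Valued.v (t j : v.adicCompletion K) ≤ Valued.v (t i : v.adicCompletion K))
    (hb : ∀ i, Valued.v (b i) ≤ exp (-M)) (i j : Fin (m + 1)) :
    Valued.v ((((colUnipotent (m + 1) (Nat.le_succ m) (Multiplicative.ofAdd b) : GL (Fin (m + 1)) (v.adicCompletion K)) :
        Matrix (Fin (m + 1)) (Fin (m + 1)) (v.adicCompletion K)) - 1) i j * t j) ≤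
      exp (-M) * Valued.v (t i : v.adicCompletion K) := by
  rw [colUnipotent_sub_one_apply]
  by_cases hi : (i : ℕ) < m
  · rw [dif_pos hi]
    by_cases hj : (j : ℕ) = m
    · have hjl : j = Fin.last m := Fin.ext (by rw [hj, Fin.val_last])
      rw [if_pos hj, Valuation.map_mul, hjl]
      exact mul_le_mul' (hb _) (hmono i (Fin.last m) (Fin.le_last i))
    · rw [if_neg hj, zero_mul, Valuation.map_zero]; exact zero_le
  · rw [dif_neg hi, zero_mul, Valuation.map_zero]; exact zero_le

/-- The last column of `u(b) diag(k₁, 1)` above the corner is `b`. [folklore] -/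
theorem colUnipotent_mul_glCorner_apply_castSucc_last (b : Fin m → v.adicCompletion K)
    (k₁ : GL (Fin m) (v.adicCompletion K)) (i : Fin m) :
    ((colUnipotent (m + 1) (Nat.le_succ m) (Multiplicative.ofAdd b) * glCorner (v.adicCompletion K) (Nat.le_succ m) k₁ :
        GL (Fin (m + 1)) (v.adicCompletion K)) : Matrix (Fin (m + 1)) (Fin (m + 1)) (v.adicCompletion K))
      (Fin.castSucc i) (Fin.last m) = b i := by
  rw [Units.val_mul, Matrix.mul_apply, Finset.sum_eq_single (Fin.last m)]
  · rw [glCorner_last_apply, if_pos rfl, mul_one, colUnipotent_apply_val, if_neg (Fin.castSucc_lt_last i).ne,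
      zero_add, dif_pos (by rw [Fin.val_castSucc]; exact i.2), if_pos (Fin.val_last m)]
    exact congrArg b (Fin.ext rfl)
  · intro l _ hl
    obtain ⟨l', rfl⟩ := Fin.exists_castSucc_eq.2 hl
    rw [glCorner_castSucc_last, mul_zero]
  · exact fun h => absurd (Finset.mem_univ _) h

/-- **Descent of a decomposition `diag(x, 1) = u k`, `u ∈ N_{m+1}(K_v)`, to `GL_m`**: `k` lies in the
mirabolic, so `k = u(b) diag(k₁, 1)` with `b` the last column of `k` above the corner
(`exists_colUnipotent_mul_glCorner_eq_of_mem_mirabolic`), and `x k₁⁻¹ ∈ N_m(K_v)` (its corner is `u u(b)`).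
[folklore] -/
theorem corner_descent {x : GL (Fin m) (v.adicCompletion K)} {u k : GL (Fin (m + 1)) (v.adicCompletion K)}
    (hu : u ∈ upperUnitriangular (Fin (m + 1)) (v.adicCompletion K))
    (h : glCorner (v.adicCompletion K) (Nat.le_succ m) x = u * k) :
    ∃ (b : Fin m → v.adicCompletion K) (k₁ : GL (Fin m) (v.adicCompletion K)),
      (∀ i, b i = ((k : GL (Fin (m + 1)) (v.adicCompletion K)) : Matrix (Fin (m + 1)) (Fin (m + 1)) (v.adicCompletion K))
        (Fin.castSucc i) (Fin.last m)) ∧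
      colUnipotent (m + 1) (Nat.le_succ m) (Multiplicative.ofAdd b) * glCorner (v.adicCompletion K) (Nat.le_succ m) k₁ = k ∧
      x * k₁⁻¹ ∈ upperUnitriangular (Fin m) (v.adicCompletion K) := by
  have hk : k = u⁻¹ * glCorner (v.adicCompletion K) (Nat.le_succ m) x := by rw [h, inv_mul_cancel_left]
  have hkP : k ∈ Literature.LinearAlgebra.Matrix.mirabolic m (v.adicCompletion K) := by
    rw [hk]
    exact mul_mem (upperUnitriangular_le_mirabolic (inv_mem hu)) (glCorner_mem_mirabolic x)
  obtain ⟨b, k₁, hbk⟩ := exists_colUnipotent_mul_glCorner_eq_of_mem_mirabolic hkP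
  refine ⟨b, k₁, fun i => ?_, hbk, ?_⟩
  · rw [← hbk, colUnipotent_mul_glCorner_apply_castSucc_last]
  · rw [← glCorner_mem_upperUnitriangular_iff, map_mul, map_inv]
    have he : glCorner (v.adicCompletion K) (Nat.le_succ m) x * (glCorner (v.adicCompletion K) (Nat.le_succ m) k₁)⁻¹ =
        u * colUnipotent (m + 1) (Nat.le_succ m) (Multiplicative.ofAdd b) := by
      rw [h, ← hbk, mul_assoc, mul_inv_cancel_right]
    rw [he]
    exact mul_mem hu (unipotentColRange_le_upperUnitriangular (colUnipotent_mem_unipotentColRange _ b))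

end Algebra

/-! ### The corner local value theorem at a bad place -/

section LocalValue

variable {m : ℕ} {K : Type} [Field K] [NumberField K] {v : HeightOneSpectrum (𝓞 K)}
  {ψ : AddChar (AdeleRing (𝓞 K) K) Circle}
  {W : GL (Fin (m + 1)) (AdeleRing (𝓞 K) K) → ℂ} {W' : GL (Fin m) (AdeleRing (𝓞 K) K) → ℂ}
  {t : Fin (m + 1) → (v.adicCompletion K)ˣ} {M c₀ : ℤ} {d : ℕ}

/-- **Left equivariance at a base point with trivial `v`-component, in every rank `N`**:
`V(g' ι_v(u)) = ψ_v(u) V(g')` for `u ∈ N_N(K_v)` (`g'` commutes with `ι_v(u)`,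
`GLn.ofLocal_mul_eq_mul_ofLocal_of_toLocal_eq_one`; the rank-`n + 1` case is
`UnitBoxTranslateProductForm.apply_mul_ofLocal_unipotent`). [folklore] -/
theorem apply_mul_ofLocal_unipotent' {N : ℕ} {V : GL (Fin N) (AdeleRing (𝓞 K) K) → ℂ}
    (hVN : ∀ (u : ↥(adelicUnipotent N K)) (g : GL (Fin N) (AdeleRing (𝓞 K) K)),
      V ((u : GL (Fin N) (AdeleRing (𝓞 K) K)) * g) = whittakerCharFun ψ u * V g)
    {g' : GL (Fin N) (AdeleRing (𝓞 K) K)} (hg' : localComponent v g' = 1)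
    {u : GL (Fin N) (v.adicCompletion K)} (hu : u ∈ upperUnitriangular (Fin N) (v.adicCompletion K)) :
    V (g' * GLn.ofLocal N K v u) = whittakerCharFun (ψ.adicComponent v) ⟨u, hu⟩ * V g' := by
  rw [← GLn.ofLocal_mul_eq_mul_ofLocal_of_toLocal_eq_one u hg', ← whittakerCharFun_ofLocal ψ ⟨u, hu⟩]
  exact hVN ⟨GLn.ofLocal N K v u, ofLocal_mem_adelicUnipotent hu⟩ g'

/-- **Descent of `ι(x) ∈ N_v K♯_v` to `GL_m`.** For `W` spread at `v` (`IsSpreadWhittakerAt v ψ t M W`, `M ≥ 0`,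
`|t_j| ≤ |t_i|` for `i ≤ j`) and `K♯_v = {k ∈ K_{m+1,v}(𝔭^M) : W(g ι_v(k)) = W(g) ∀ g}`: if
`diag(x, 1) = u k` with `u ∈ N_{m+1}(K_v)`, `k ∈ K♯_v`, then `x = u₁ k₁` with `u₁ ∈ N_m(K_v)` and
`diag(k₁, 1) ∈ K♯_v` — by `corner_descent`, `diag(k₁, 1) = u(-b) k` with `|b_i| = |k_{i m}| ≤ exp(-M)`, and
`u(∓b)` lies in `K_v(𝔭^M)` and in the spread level set (`level_colUnipotent`, `IsSpreadWhittakerAt.level`).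
[folklore] -/
theorem sharp_descent (hW : IsSpreadWhittakerAt v ψ t M W) (hM₀ : 0 ≤ M)
    (hmono : ∀ i j : Fin (m + 1), i ≤ j → Valued.v (t j : v.adicCompletion K) ≤ Valued.v (t i : v.adicCompletion K))
    {x : GL (Fin m) (v.adicCompletion K)} {u k : GL (Fin (m + 1)) (v.adicCompletion K)}
    (hu : u ∈ upperUnitriangular (Fin (m + 1)) (v.adicCompletion K))
    (hk : k ∈ valuedCongruenceSubgroup (Fin (m + 1)) (exp (-M)))
    (hkW : ∀ g : GL (Fin (m + 1)) (AdeleRing (𝓞 K) K), W (g * GLn.ofLocal (m + 1) K v k) = W g)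
    (h : glCorner (v.adicCompletion K) (Nat.le_succ m) x = u * k) :
    ∃ u₁ ∈ upperUnitriangular (Fin m) (v.adicCompletion K), ∃ k₁ : GL (Fin m) (v.adicCompletion K),
      (glCorner (v.adicCompletion K) (Nat.le_succ m) k₁ ∈ valuedCongruenceSubgroup (Fin (m + 1)) (exp (-M)) ∧
        ∀ g : GL (Fin (m + 1)) (AdeleRing (𝓞 K) K),
          W (g * GLn.ofLocal (m + 1) K v (glCorner (v.adicCompletion K) (Nat.le_succ m) k₁)) = W g) ∧
      x = u₁ * k₁ := by
  obtain ⟨b, k₁, hb, hbk, hu₁⟩ := corner_descent hu h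
  have hexpM : exp (-M) ≤ (1 : ℤᵐ⁰) := by rw [← exp_zero, exp_le_exp]; omega
  -- `|b_i| = |k_{i m}| ≤ exp(-M)`
  have hbv : ∀ i, Valued.v (b i) ≤ exp (-M) := fun i => by
    have h3 := (mem_valuedCongruenceSubgroup_iff.1 hk).2.2 (Fin.castSucc i) (Fin.last m)
    rw [Matrix.sub_apply, Matrix.one_apply_ne (Fin.castSucc_lt_last i).ne, sub_zero, ← hb i] at h3
    exact h3
  have hnbv : ∀ i, Valued.v ((-b) i) ≤ exp (-M) := fun i => by rw [Pi.neg_apply, Valuation.map_neg]; exact hbv i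
  -- `diag(k₁, 1) = u(-b) k`
  set C : GL (Fin (m + 1)) (v.adicCompletion K) := colUnipotent (m + 1) (Nat.le_succ m) (Multiplicative.ofAdd (-b))
    with hC
  have hCk : glCorner (v.adicCompletion K) (Nat.le_succ m) k₁ = C * k := by
    rw [← hbk, ← mul_assoc, hC, ofAdd_neg, map_inv, inv_mul_cancel, one_mul]
  have hCK : C ∈ valuedCongruenceSubgroup (Fin (m + 1)) (exp (-M)) := colUnipotent_mem_valuedCongruenceSubgroup hexpM hnbv
  have hCW : ∀ g : GL (Fin (m + 1)) (AdeleRing (𝓞 K) K), W (g * GLn.ofLocal (m + 1) K v C) = W g := by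
    refine hW.level C (level_colUnipotent hmono hnbv) (fun i j => ?_)
    rw [hC, ← map_inv, ← ofAdd_neg, neg_neg]
    exact level_colUnipotent hmono hbv i j
  refine ⟨x * k₁⁻¹, hu₁, k₁, ⟨?_, fun g => ?_⟩, (inv_mul_cancel_right x k₁).symm⟩
  · rw [hCk]; exact mul_mem hCK hk
  · rw [hCk, map_mul, ← mul_assoc, hkW, hCW]

/-- **The corner local value theorem at a bad place** (Jacquet–Piatetski-Shapiro–Shalika (1983), (2.7), in the
tree's form, for `GL_{m+1} × GL_m`). Let `W` on `GL_{m+1}(𝔸_K)` be left `ψ`-equivariant and spread at `v` (with the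
usual hypotheses on `ψ_v`, `M`, `t`, and a depth `d` with `exp(-d)|t_0| ≤ exp(-M)|t_m|`), `W'` on `GL_m(𝔸_K)` left
`ψ`-equivariant and right `K_{m,v}(𝔭^M)`-invariant, `G'`, `g'` base points with trivial `v`-components and
`x ∈ GL_m(K_v)` ARBITRARY. Then `W(G' ι_v(diag(x, 1))) W̄'(g' ι_v(x)) = 𝟙[diag(x, 1) ∈ N_v K♯_v] · W(G') W̄'(g')`:
off `N_v K♯_v` the first factor vanishes, the last row of `diag(x, 1)` being exactly `e_{m+1}`
(`exists_sharp_of_ne_zero` at depth `d`); on it `sharp_descent` gives `x = u₁ k₁` with `diag(k₁, 1) ∈ K♯_v`, both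
functions take the value `ψ_v(u₁) ×` (value at the base point) (`whittakerCharFun_glCornerU`), and the phases
cancel. [folklore] -/
theorem corner_pair_apply_mul_ofLocal_eq
    (hWN : ∀ (u : ↥(adelicUnipotent (m + 1) K)) (g : GL (Fin (m + 1)) (AdeleRing (𝓞 K) K)),
      W ((u : GL (Fin (m + 1)) (AdeleRing (𝓞 K) K)) * g) = whittakerCharFun ψ u * W g)
    (hW'N : ∀ (u : ↥(adelicUnipotent m K)) (g : GL (Fin m) (AdeleRing (𝓞 K) K)),
      W' ((u : GL (Fin m) (AdeleRing (𝓞 K) K)) * g) = whittakerCharFun ψ u * W' g)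
    (hW : IsSpreadWhittakerAt v ψ t M W)
    (hψv : ∃ y : v.adicCompletion K, Valued.v y ≤ exp (1 - c₀) ∧ ψ.adicComponent v y ≠ 1) (hM₁ : 1 ≤ M)
    (hmono : ∀ i j : Fin (m + 1), i ≤ j → Valued.v (t j : v.adicCompletion K) ≤ Valued.v (t i : v.adicCompletion K))
    (hgap : ∀ i j : Fin (m + 1), (i : ℕ) + 1 = j →
      exp (M - c₀) * Valued.v (t j : v.adicCompletion K) ≤ Valued.v (t i : v.adicCompletion K))
    (hmt : exp (-(d : ℤ)) * Valued.v (t 0 : v.adicCompletion K) ≤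
      exp (-M) * Valued.v (t (Fin.last m) : v.adicCompletion K))
    (hW'K : ∀ κ ∈ valuedCongruenceSubgroup (Fin m) (exp (-M)), ∀ g : GL (Fin m) (AdeleRing (𝓞 K) K),
      W' (g * GLn.ofLocal m K v κ) = W' g)
    {G' : GL (Fin (m + 1)) (AdeleRing (𝓞 K) K)} (hG' : localComponent v G' = 1)
    {g' : GL (Fin m) (AdeleRing (𝓞 K) K)} (hg' : localComponent v g' = 1) (x : GL (Fin m) (v.adicCompletion K)) :
    W (G' * GLn.ofLocal (m + 1) K v (glCorner (v.adicCompletion K) (Nat.le_succ m) x)) *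
        star (W' (g' * GLn.ofLocal m K v x)) =
      (if ∃ u ∈ upperUnitriangular (Fin (m + 1)) (v.adicCompletion K), ∃ k : GL (Fin (m + 1)) (v.adicCompletion K),
          (k ∈ valuedCongruenceSubgroup (Fin (m + 1)) (exp (-M)) ∧
            ∀ g : GL (Fin (m + 1)) (AdeleRing (𝓞 K) K), W (g * GLn.ofLocal (m + 1) K v k) = W g) ∧
            glCorner (v.adicCompletion K) (Nat.le_succ m) x = u * k
        then (1 : ℂ) else 0) * (W G' * star (W' g')) := by
  split_ifs with hJ
  · obtain ⟨u, hu, k, ⟨hkK, hkW⟩, hxuk⟩ := hJ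
    obtain ⟨u₁, hu₁, k₁, ⟨hk₁K, hk₁W⟩, rfl⟩ := sharp_descent hW (by omega) hmono hu hkK hkW hxuk
    have hWv : W (G' * GLn.ofLocal (m + 1) K v (glCorner (v.adicCompletion K) (Nat.le_succ m) (u₁ * k₁))) =
        whittakerCharFun (ψ.adicComponent v) ⟨u₁, hu₁⟩ * W G' := by
      rw [map_mul, UnitBoxTranslateProductForm.apply_mul_ofLocal_unipotent_mul_sharp hWN hG'
        (glCorner_mem_upperUnitriangular (Nat.le_succ m) hu₁) hk₁W]
      exact congrArg (· * W G') (whittakerCharFun_glCornerU (ψ.adicComponent v) (Nat.le_succ m) ⟨u₁, hu₁⟩)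
    have hW'v : W' (g' * GLn.ofLocal m K v (u₁ * k₁)) = whittakerCharFun (ψ.adicComponent v) ⟨u₁, hu₁⟩ * W' g' := by
      rw [map_mul, ← mul_assoc, hW'K k₁ ((glCorner_mem_valuedCongruenceSubgroup_iff k₁).1 hk₁K),
        apply_mul_ofLocal_unipotent' hW'N hg' hu₁]
    rw [hWv, hW'v, star_mul', one_mul]
    calc whittakerCharFun (ψ.adicComponent v) ⟨u₁, hu₁⟩ * W G' *
          (star (whittakerCharFun (ψ.adicComponent v) ⟨u₁, hu₁⟩) * star (W' g'))
        = (whittakerCharFun (ψ.adicComponent v) ⟨u₁, hu₁⟩ * star (whittakerCharFun (ψ.adicComponent v) ⟨u₁, hu₁⟩)) *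
            (W G' * star (W' g')) := by ring
      _ = W G' * star (W' g') := by rw [UnitBoxTranslateProductForm.whittakerCharFun_mul_star, one_mul]
  · rw [zero_mul]
    by_cases hne : W (G' * GLn.ofLocal (m + 1) K v (glCorner (v.adicCompletion K) (Nat.le_succ m) x)) = 0
    · rw [hne, zero_mul]
    · refine absurd (UnitBoxTranslateProductForm.exists_sharp_of_ne_zero hWN hW hψv hM₁ hmono hgap hmt hG'
        (fun j => ?_) hne) hJ
      rw [glCorner_last_apply, sub_self, Valuation.map_zero]
      exact zero_le

end LocalValue

/-! ### The registered sub-goal: the corner local value theorem -/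

section SubGoal

/-- **SUB-GOAL (W-CPF, part 1) — the corner local value theorem at a bad place**, `∀`-form of
`corner_pair_apply_mul_ofLocal_eq`: for `W` left `ψ`-equivariant on `GL_{m+1}(𝔸_K)` and spread at `v`, `W'` left
`ψ`-equivariant on `GL_m(𝔸_K)` and right `K_{m,v}(𝔭^M)`-invariant, base points `G'`, `g'` with trivial
`v`-components and any `x ∈ GL_m(K_v)`:
`W(G' ι_v(diag(x, 1))) W̄'(g' ι_v(x)) = 𝟙[diag(x, 1) ∈ N_v K♯_v] · W(G') W̄'(g')`
(Jacquet–Piatetski-Shapiro–Shalika (1983), (2.7), corner case). [folklore] -/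
theorem stub_corner_unitBox_localValue :
    ∀ {m : ℕ} {K : Type} [Field K] [NumberField K] {v : HeightOneSpectrum (𝓞 K)}
      {ψ : AddChar (AdeleRing (𝓞 K) K) Circle}
      {W : GL (Fin (m + 1)) (AdeleRing (𝓞 K) K) → ℂ} {W' : GL (Fin m) (AdeleRing (𝓞 K) K) → ℂ}
      {t : Fin (m + 1) → (v.adicCompletion K)ˣ} {M c₀ : ℤ} {d : ℕ}
      (_ : ∀ (u : ↥(adelicUnipotent (m + 1) K)) (g : GL (Fin (m + 1)) (AdeleRing (𝓞 K) K)), W ((u : GL (Fin (m + 1)) (AdeleRing (𝓞 K) K)) * g) = whittakerCharFun ψ u * W g)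
      (_ : ∀ (u : ↥(adelicUnipotent m K)) (g : GL (Fin m) (AdeleRing (𝓞 K) K)), W' ((u : GL (Fin m) (AdeleRing (𝓞 K) K)) * g) = whittakerCharFun ψ u * W' g)
      (_ : IsSpreadWhittakerAt v ψ t M W)
      (_ : ∃ y : v.adicCompletion K, Valued.v y ≤ exp (1 - c₀) ∧ ψ.adicComponent v y ≠ 1) (_ : 1 ≤ M)
      (_ : ∀ i j : Fin (m + 1), i ≤ j → Valued.v (t j : v.adicCompletion K) ≤ Valued.v (t i : v.adicCompletion K))
      (_ : ∀ i j : Fin (m + 1), (i : ℕ) + 1 = j → exp (M - c₀) * Valued.v (t j : v.adicCompletion K) ≤ Valued.v (t i : v.adicCompletion K))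
      (_ : exp (-(d : ℤ)) * Valued.v (t 0 : v.adicCompletion K) ≤ exp (-M) * Valued.v (t (Fin.last m) : v.adicCompletion K))
      (_ : ∀ κ ∈ valuedCongruenceSubgroup (Fin m) (exp (-M)), ∀ g : GL (Fin m) (AdeleRing (𝓞 K) K), W' (g * GLn.ofLocal m K v κ) = W' g)
      {G' : GL (Fin (m + 1)) (AdeleRing (𝓞 K) K)} (_ : localComponent v G' = 1)
      {g' : GL (Fin m) (AdeleRing (𝓞 K) K)} (_ : localComponent v g' = 1) (x : GL (Fin m) (v.adicCompletion K)),
    W (G' * GLn.ofLocal (m + 1) K v (glCorner (v.adicCompletion K) (Nat.le_succ m) x)) * star (W' (g' * GLn.ofLocal m K v x)) = (if ∃ u ∈ upperUnitriangular (Fin (m + 1)) (v.adicCompletion K), ∃ k : GL (Fin (m + 1)) (v.adicCompletion K), (k ∈ valuedCongruenceSubgroup (Fin (m + 1)) (exp (-M)) ∧ ∀ g : GL (Fin (m + 1)) (AdeleRing (𝓞 K) K), W (g * GLn.ofLocal (m + 1) K v k) = W g) ∧ glCorner (v.adicCompletion K) (Nat.le_succ m) x = u * k then (1 : ℂ) else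 0) * (W G' * star (W' g')) := by
  intro m K _ _ v ψ W W' t M c₀ d hWN hW'N hW hψv hM₁ hmono hgap hmt hW'K G' hG' g' hg' x
  exact corner_pair_apply_mul_ofLocal_eq hWN hW'N hW hψv hM₁ hmono hgap hmt hW'K hG' hg' x

end SubGoal

end Summit.Langlands.Langlands.Theorems.CornerUnitBoxProductForm
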